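import Mathlib
import HarnessLib
import Literature.NumberTheory.GaloisRepresentations.AdequacyOrthogonalDegreeThree

/-!
# Multiply-wound `SU(3)` loops: `U^{k+3} = t U^{k+2} − t̄ U^{k+1} + U^k` and the trace recursion `tr U^{k+3} = t·tr U^{k+2} − t̄·tr U^{k+1} + tr U^k`, with `tr U⁴ = t⁴ − 4t²t̄ + 2t̄² + 4t`

HONEST FRAMING: exact (Metropolis-corrected) sampling algorithms for lattice gauge theory;
figures of merit are autocorrelation/cost numbers at stated couplings and volumes; no
continuum-physics claim.

Venture `LatticeQCDFlow` (cell pub-lqcd), sub-topic `Scoring`; FANOUT row 21 (`su3-base`: the 4D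
`SU(3)` baselines).  NEW WORK of the cell (placement rule), elementary, over the Literature's `3 × 3`
Cayley–Hamilton identity (`OrthogonalDegreeThree.cayleyHamilton_fin_three`, imported) and Mathlib;
no definition is introduced; nothing is cited as a fact; no number of ours.  Companion of row 21
GEN-8's `Scoring/SU3CayleyHamilton` (`U³ − tU² + t̄U − 1 = 0`, `tr U² = t² − 2t̄`,
`tr U³ = t³ − 3tt̄ + 3`; re-derived here in three lines so that this file does not wait for that
module's build).

Every class function of a single `SU(3)` holonomy is a function of `t = tr U`
(`Scoring/SU3ConjugacyByTrace`); for the traces of the MULTIPLY-WOUND loops `tr U^k` (the `k`-fold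
plaquette / Polyakov loop) the function is an explicit integer polynomial in `t, t̄`, generated by
the linear recursion obtained by multiplying Cayley–Hamilton by `U^k`:

  `U^{k+3} = t U^{k+2} − t̄ U^{k+1} + U^k`,  `tr U^{k+3} = t tr U^{k+2} − t̄ tr U^{k+1} + tr U^k`,

with initial values `tr U⁰ = 3`, `tr U = t`, `tr U² = t² − 2t̄`.

## What is proved (`U ∈ SU(3)` as a matrix with membership, `t = tr U`)

* `su3_pow_add_three` — `U^{k+3} = t•U^{k+2} − t̄•U^{k+1} + U^k` for every `k`;
* **`su3_trace_pow_add_three`** — the trace recursion;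
* `su3_trace_pow_zero` (`= 3`), **`su3_trace_pow_four`** (`= t⁴ − 4t²t̄ + 2t̄² + 4t`),
  **`su3_trace_pow_five`** (`= t⁵ − 5t³t̄ + 5tt̄² + 5t² − 5t̄`); the cases `k = 2, 3` are row 21
  GEN-8's `SU3CayleyHamilton.su3_trace_sq` / `su3_trace_pow_three` (not restated; used as local
  steps).

NOT CLAIMED: anything about expectations of multiply-wound loops; anything for `N ≠ 3`.
-/

namespace Summit.Ventures.LatticeQCDFlow.Scoring

open Matrix
open Literature.NumberTheory.GaloisRepresentations.OrthogonalDegreeThree (cayleyHamilton_fin_three)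

section SpecialUnitaryThree

variable {U : Matrix (Fin 3) (Fin 3) ℂ}

/-- Cayley–Hamilton on `SU(3)` in the solved form `U³ = tU² − t̄U + 1` (re-derived: `adj U = U†`
gives `tr adj U = conj tr U`, and `det U = 1`). -/
theorem su3_pow_three_eq (hU : U ∈ Matrix.specialUnitaryGroup (Fin 3) ℂ) :
    U ^ 3 = U.trace • U ^ 2 - ((starRingEnd ℂ) U.trace) • U + 1 := by
  have hdet : U.det = 1 := (Matrix.mem_specialUnitaryGroup_iff.mp hU).2
  have hadj : adjugate U = star U := by
    have h1 : U * adjugate U = 1 := by rw [mul_adjugate, hdet, one_smul]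
    calc adjugate U = (star U * U) * adjugate U := by
          rw [Unitary.star_mul_self_of_mem (Matrix.mem_specialUnitaryGroup_iff.mp hU).1, Matrix.one_mul]
      _ = star U := by rw [Matrix.mul_assoc, h1, Matrix.mul_one]
  have htr : (adjugate U).trace = (starRingEnd ℂ) U.trace := by
    rw [hadj, star_eq_conjTranspose, trace_conjTranspose, Complex.star_def]
  have h := cayleyHamilton_fin_three U
  rw [htr, hdet, one_smul] at h
  -- `h : U³ − t•U² + t̄•U − 1 = 0`
  have h' : U ^ 3 = U ^ 3 - U.trace • U ^ 2 + ((starRingEnd ℂ) U.trace) • U - 1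
      + (U.trace • U ^ 2 - ((starRingEnd ℂ) U.trace) • U + 1) := by abel
  rw [h, zero_add] at h'
  exact h'

/-- **The three-term recursion for powers**: `U^{k+3} = t•U^{k+2} − t̄•U^{k+1} + U^k`. -/
theorem su3_pow_add_three (hU : U ∈ Matrix.specialUnitaryGroup (Fin 3) ℂ) (k : ℕ) :
    U ^ (k + 3) = U.trace • U ^ (k + 2) - ((starRingEnd ℂ) U.trace) • U ^ (k + 1) + U ^ k := by
  rw [pow_add, su3_pow_three_eq hU, Matrix.mul_add, Matrix.mul_sub, Matrix.mul_smul, Matrix.mul_smul,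
    Matrix.mul_one, ← pow_add, ← pow_succ]

/-- **The trace recursion for multiply-wound loops**:
`tr U^{k+3} = t·tr U^{k+2} − t̄·tr U^{k+1} + tr U^k`. -/
theorem su3_trace_pow_add_three (hU : U ∈ Matrix.specialUnitaryGroup (Fin 3) ℂ) (k : ℕ) :
    (U ^ (k + 3)).trace =
      U.trace * (U ^ (k + 2)).trace - (starRingEnd ℂ) U.trace * (U ^ (k + 1)).trace + (U ^ k).trace := by
  rw [su3_pow_add_three hU k, Matrix.trace_add, Matrix.trace_sub, Matrix.trace_smul, Matrix.trace_smul,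
    smul_eq_mul, smul_eq_mul]

/-- `tr U⁰ = 3`. -/
theorem su3_trace_pow_zero (U : Matrix (Fin 3) (Fin 3) ℂ) : (U ^ 0).trace = 3 := by
  rw [pow_zero, Matrix.trace_one, Fintype.card_fin]
  norm_num

/-- **`tr U⁴ = t⁴ − 4t²t̄ + 2t̄² + 4t`** on `SU(3)`. -/
theorem su3_trace_pow_four (hU : U ∈ Matrix.specialUnitaryGroup (Fin 3) ℂ) :
    (U ^ 4).trace = U.trace ^ 4 - 4 * U.trace ^ 2 * (starRingEnd ℂ) U.trace
      + 2 * ((starRingEnd ℂ) U.trace) ^ 2 + 4 * U.trace := by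
  -- `tr U² = t² − 2t̄` and `tr U³ = t³ − 3tt̄ + 3` (row 21 GEN-8's `SU3CayleyHamilton.su3_trace_sq` /
  -- `su3_trace_pow_three`, re-derived as local steps: that module's olean is not yet available)
  have hunit := (Matrix.mem_specialUnitaryGroup_iff.mp hU).1
  have h2 : (U ^ 2).trace = U.trace ^ 2 - 2 * (starRingEnd ℂ) U.trace := by
    have h3 := su3_pow_three_eq hU
    have hU' : U ^ 2 = U.trace • U - ((starRingEnd ℂ) U.trace) • (1 : Matrix (Fin 3) (Fin 3) ℂ) + star U := by
      have h : U ^ 3 * star U = (U.trace • U ^ 2 - ((starRingEnd ℂ) U.trace) • U + 1) * star U := by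
        rw [h3]
      rw [Matrix.add_mul, Matrix.sub_mul, Matrix.smul_mul, Matrix.smul_mul, Matrix.one_mul,
        show U ^ 3 * star U = U ^ 2 by
          rw [pow_succ, Matrix.mul_assoc, Unitary.mul_star_self_of_mem hunit, Matrix.mul_one],
        show U ^ 2 * star U = U by
          rw [pow_succ, Matrix.mul_assoc, Unitary.mul_star_self_of_mem hunit, Matrix.mul_one, pow_one],
        Unitary.mul_star_self_of_mem hunit] at h
      exact h
    rw [hU', Matrix.trace_add, Matrix.trace_sub, Matrix.trace_smul, Matrix.trace_smul, Matrix.trace_one,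
      Fintype.card_fin, star_eq_conjTranspose, trace_conjTranspose, Complex.star_def, smul_eq_mul,
      smul_eq_mul]
    push_cast
    ring
  have h3 : (U ^ 3).trace = U.trace ^ 3 - 3 * U.trace * (starRingEnd ℂ) U.trace + 3 := by
    have h := su3_trace_pow_add_three hU 0
    rw [zero_add, show (0 : ℕ) + 2 = 2 from rfl, show (0 : ℕ) + 1 = 1 from rfl, pow_one, h2,
      su3_trace_pow_zero] at h
    rw [h]
    ring
  have h := su3_trace_pow_add_three hU 1
  rw [show (1 : ℕ) + 3 = 4 from rfl, show (1 : ℕ) + 2 = 3 from rfl, show (1 : ℕ) + 1 = 2 from rfl,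
    pow_one, h3, h2] at h
  rw [h]
  ring

/-- `tr U⁵ = t⁵ − 5t³t̄ + 5tt̄² + 5t² − 5t̄` on `SU(3)`. -/
theorem su3_trace_pow_five (hU : U ∈ Matrix.specialUnitaryGroup (Fin 3) ℂ) :
    (U ^ 5).trace = U.trace ^ 5 - 5 * U.trace ^ 3 * (starRingEnd ℂ) U.trace
      + 5 * U.trace * ((starRingEnd ℂ) U.trace) ^ 2 + 5 * U.trace ^ 2 - 5 * (starRingEnd ℂ) U.trace := by
  -- `tr U² = t² − 2t̄` and `tr U³ = t³ − 3tt̄ + 3` (row 21 GEN-8's `SU3CayleyHamilton.su3_trace_sq` /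
  -- `su3_trace_pow_three`, re-derived as local steps: that module's olean is not yet available)
  have hunit := (Matrix.mem_specialUnitaryGroup_iff.mp hU).1
  have h2 : (U ^ 2).trace = U.trace ^ 2 - 2 * (starRingEnd ℂ) U.trace := by
    have h3 := su3_pow_three_eq hU
    have hU' : U ^ 2 = U.trace • U - ((starRingEnd ℂ) U.trace) • (1 : Matrix (Fin 3) (Fin 3) ℂ) + star U := by
      have h : U ^ 3 * star U = (U.trace • U ^ 2 - ((starRingEnd ℂ) U.trace) • U + 1) * star U := by
        rw [h3]
      rw [Matrix.add_mul, Matrix.sub_mul, Matrix.smul_mul, Matrix.smul_mul, Matrix.one_mul,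
        show U ^ 3 * star U = U ^ 2 by
          rw [pow_succ, Matrix.mul_assoc, Unitary.mul_star_self_of_mem hunit, Matrix.mul_one],
        show U ^ 2 * star U = U by
          rw [pow_succ, Matrix.mul_assoc, Unitary.mul_star_self_of_mem hunit, Matrix.mul_one, pow_one],
        Unitary.mul_star_self_of_mem hunit] at h
      exact h
    rw [hU', Matrix.trace_add, Matrix.trace_sub, Matrix.trace_smul, Matrix.trace_smul, Matrix.trace_one,
      Fintype.card_fin, star_eq_conjTranspose, trace_conjTranspose, Complex.star_def, smul_eq_mul,
      smul_eq_mul]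
    push_cast
    ring
  have h3 : (U ^ 3).trace = U.trace ^ 3 - 3 * U.trace * (starRingEnd ℂ) U.trace + 3 := by
    have h := su3_trace_pow_add_three hU 0
    rw [zero_add, show (0 : ℕ) + 2 = 2 from rfl, show (0 : ℕ) + 1 = 1 from rfl, pow_one, h2,
      su3_trace_pow_zero] at h
    rw [h]
    ring
  have h := su3_trace_pow_add_three hU 2
  rw [show (2 : ℕ) + 3 = 5 from rfl, show (2 : ℕ) + 2 = 4 from rfl, show (2 : ℕ) + 1 = 3 from rfl,
    su3_trace_pow_four hU, h3, h2] at h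
  rw [h]
  ring

end SpecialUnitaryThree

end Summit.Ventures.LatticeQCDFlow.Scoring
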